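import Mathlib
import Summits.KontsevichZagierPeriods.Zeta5Search.LawA3Proof
import Summits.KontsevichZagierPeriods.Zeta5Search.KSecondOrderAssembly
import Summits.KontsevichZagierPeriods.Zeta5Search.CasoratianClassBoundProof
import HarnessLib

/-!
# ζ(5) search — THEOREM A‴ IN `𝒦`-FORM (`lawA3K`): `v_p(Cas_j(b)) ≥ 6 − 2M` for EVERY even `M ≥ 4` in the degree regime `p ≤ d` (DENOM-LAW D1, prover-d1 gen 19)

HONEST FRAMING: systematic search; no irrationality claim unless certified.  Cell `pub-zeta5`, track «DENOM-LAW» D1, seat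
`denom-prover-d1` gen 19 (`HOME/denom-law/prover-d1/ATTEMPT-19.md`).  THEOREM A‴₄ = the cell's K-candidate K-A‴₄ («THEOREM A‴ extends to the
frame M = 4 on the deep-pair configuration: v ≥ 6 − 2M = −2»; blind leg SEALED 2026-08-27 09:25Z and scored HIT at p = 17, kit j274716:
1,523 / 1,523 instances) IS A THEOREM, in the following form:

**`lawA3K`.**  Window prime `5 ≤ p ≤ b₀ < p² − 2`, `b` and `b + e_j` in the polytope, DEGREE REGIME `p ≤ d(b)`, `M ≥ 4` EVEN, and the class
hypotheses H1–H4 of `SecondOrder.LawA3` verbatim (every multipole class `E ≥ −M`, every single-pole class `ν ≥ −M+1`, every class of exponent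
`−M` centre-free of ONE palindromic type list `T`, every pole class with `ν = −M+1` a single raise of `T` or the odd-centre class of type `T`)
⟹ `v_p(Cas_j(b)) ≥ 6 − 2M`.  For `M ≥ 6` this is typer g11's `lawA3_holds` (which needs no `p ≤ d`); the NEW content is `M = 4`, where the
`W`-form of the proof fails (order-≥3 tame single-pole classes carry unit `W`-digits, `SecondOrderPair.restW_norm` needs `m ≤ −5`) and the
statement without `p ≤ d` is FALSE (at `d < p` the value is `5 − 2M`: 285 / 294 blind-leg instances, e.g. `b = (22;11,11,11,11,5,5,5)`, `p = 11`).

PROOF (the `𝒦`-form).  With `p ≤ d` both moment parts `Ω_p(b)`, `Ω_p(b + e_j)` of the ζ(3)-coefficient vanish (`omegaRes_eq_zero`,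
`casoratian_split`), so `Cas_j(b) = 𝒦_p(b)V(b⁺) − 𝒦_p(b⁺)V(b)`.  `aggregateK` (file `KSecondOrderAssembly`) for `b` and `b + e_j` gives
`𝒦/(−p)^{m+3} ≡ −pX`, `V/(−p)^m ≡ −pY` with `(X, Y) ≡ α (τ_K(T), τ_V(T))` — the SAME direction for `b` and `b + e_j` since `τ_K, τ_V` are read
off the list `T` — whence `det_small` (typer g11) gives three digits.  Ingredients new in gen 19: the classwise second `𝒦`-digit
`secondDigitK` (`E ≤ −4`), the `𝒦`-orbit identity `live_pairK`, `deep_dataK`; every single-pole class has `v(𝒦) ≥ 1`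
(`singlePoleClassKBound_holds`), so tame singles never enter.  The transports of H2, H4 are typer g11's `H2_shift`, `H4_shift` inlined
with `6 ≤ M` weakened to `4 ≤ M` (their proofs use only `M ≥ 2`).  `p`-adic valuations of rational numbers; nothing here bears on
irrationality; nothing about ζ(5), no γ; records in print UNMOVED.
-/

noncomputable section

open Finset PowerSeries

namespace Summit.KontsevichZagierPeriods.Zeta5Search.SecondOrder

open Summit.KontsevichZagierPeriods.Zeta5Search.DualSeries (InBox)
open Summit.KontsevichZagierPeriods.Zeta5Search.WedgeDictionary (coeffW coeffV dOf)
open Summit.KontsevichZagierPeriods.Zeta5Search.CasoratianValuation (InPolytope shift casoratian)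
open Summit.KontsevichZagierPeriods.Zeta5Search.ClusterValuation
open Summit.KontsevichZagierPeriods.Zeta5Search.PadicSeries
open Summit.KontsevichZagierPeriods.Zeta5Search.BigPrime (shift_zero dOf_shift)
open Summit.KontsevichZagierPeriods.Zeta5Search.CellKit (two_mul_le_of_shift classExp_shift_eq unhit_of_classExp_eq netExp_shift_of_unhit)
open Literature.NumberTheory.Transcendental.BallRivoal (harm)

variable {p : ℕ} [hp : Fact p.Prime]

/-! ## THEOREM A‴ in `𝒦`-form -/

/-- **THEOREM A‴ IN `𝒦`-FORM** (`M ≥ 4` even, degree regime `p ≤ d`): under the class hypotheses of `SecondOrder.LawA3`,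
`v_p(Cas_j(b)) ≥ 6 − 2M`.  At `M = 4` this is THEOREM A‴₄ (K-A‴₄, blind leg HIT j274716); for `M ≥ 6` it agrees with `lawA3_holds`. -/
theorem lawA3K (b : ℕ → ℤ) (p j M : ℕ) (T : List ℤ) (hb : InPolytope b) (hb' : InPolytope (shift b j)) (hj1 : 1 ≤ j) (hj7 : j ≤ 7)
    (hprime : p.Prime) (hp5 : 5 ≤ p) (hpb : (p : ℤ) ≤ b 0) (hwin : (b 0 + 2 : ℤ) < (p : ℤ) ^ 2) (hpd : (p : ℤ) ≤ dOf b)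
    (hM : 4 ≤ M) (hMe : Even M) (hT : T.reverse = T)
    (H1 : ∀ x ∈ multipoleClasses b p, -(M : ℤ) ≤ classExp b p x)
    (H2 : ∀ y, y < p → classPoleCount b p y = 1 → -(M : ℤ) + 1 ≤ classNu b p y)
    (H3 : ∀ x ∈ multipoleClasses b p, classExp b p x = -(M : ℤ) → ¬ CentreIn b p x ∧ classTypeList b p x = T)
    (H4 : ∀ y, y < p → 1 ≤ classPoleCount b p y → classNu b p y = -(M : ℤ) + 1 →
      isRaise T (classTypeList b p y) = true ∨ (¬ (2 : ℤ) ∣ b 0 ∧ CentreIn b p y ∧ classTypeList b p y = T))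
    (hcas : casoratian b j ≠ 0) : (6 : ℤ) - 2 * M ≤ padicValRat p (casoratian b j) := by
  haveI : Fact p.Prime := ⟨hprime⟩
  have hp0 : (p : ℚ) ≠ 0 := Nat.cast_ne_zero.2 hprime.ne_zero
  have hpneg : (-(p : ℚ)) ≠ 0 := neg_ne_zero.2 hp0
  -- the aggregates for `b` and `b + e_j`
  obtain ⟨α, X, Y, hX1, hY1, hK, hV, hXa, hYa⟩ := aggregateK b hb hp5 hpb hwin hM hMe hT H1 H2 H3 H4
  have hpb' : (p : ℤ) ≤ shift b j 0 := by rw [shift_zero b hj1]; exact hpb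
  have hwin' : (shift b j 0 + 2 : ℤ) < (p : ℤ) ^ 2 := by rw [shift_zero b hj1]; exact hwin
  -- transport of H2 and H4 to `b + e_j` (typer g11's `H2_shift`, `H4_shift`, whose statements ask `6 ≤ M` but whose proofs use
  -- only `M ≥ 2`; inlined here with `4 ≤ M`)
  have H2' : ∀ y, y < p → classPoleCount (shift b j) p y = 1 → -(M : ℤ) + 1 ≤ classNu (shift b j) p y := by
      intro y hy h1
      have hge := classExp_shift_ge b hb.1 hj1 p y
      have hnu := CellA.classExp_le_classNu (shift b j) p y
      have hcb := classPoleCount_shift_le b hb.1 hj1 p y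
      by_cases h2 : 2 ≤ classPoleCount b p y
      · have hE := H1 y (mem_filter.2 ⟨mem_range.2 hy, h2⟩)
        by_contra hlt
        have heq : classExp (shift b j) p y = classExp b p y := by omega
        have := classPoleCount_shift_of_classExp_eq b hb.1 hj1 heq
        omega
      · have h1b : classPoleCount b p y = 1 := by omega
        have hnub := H2 y hy h1b
        by_cases heq : classNu b p y = classExp b p y
        · omega
        · -- tame in `b`, hence tame in `b + e_j`
          have htame : tameSingle b p y = true := by
            by_contra ht
            apply heq
            unfold classNu; rw [if_neg (fun h => ht h.2)]
          have ht' := tameSingle_shift b hb hb' hj1 hj7 h1b (by omega) htame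
          unfold classNu; rw [if_pos ⟨h1, ht'⟩]
          exact le_trans (by omega) (le_max_right _ _)

  have H4' : ∀ y, y < p → 1 ≤ classPoleCount (shift b j) p y → classNu (shift b j) p y = -(M : ℤ) + 1 →
      isRaise T (classTypeList (shift b j) p y) = true ∨
        (¬ (2 : ℤ) ∣ shift b j 0 ∧ CentreIn (shift b j) p y ∧ classTypeList (shift b j) p y = T) := by
      intro y hy h1 hnu
      have hp0 : 0 < p := hprime.pos
      have hyn : y ≤ (b 0).toNat := le_b0_of_lt b hpb hy
      have hcb := classPoleCount_shift_le b hb.1 hj1 p y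
      have hge := classExp_shift_ge b hb.1 hj1 p y
      -- `ν⁺ = E⁺ = −M+1` (a tame single class has `ν ≥ 0`)
      have hEq : classNu (shift b j) p y = classExp (shift b j) p y := by
        by_contra hne
        have := (tame_of_classNu_ne (shift b j) hne).2; omega
      have hE' : classExp (shift b j) p y = -(M : ℤ) + 1 := by rw [← hEq]; exact hnu
      by_cases heq : classExp (shift b j) p y = classExp b p y
      · -- unhit: everything transports
        have h1b : 1 ≤ classPoleCount b p y := by rw [← classPoleCount_shift_of_classExp_eq b hb.1 hj1 heq]; exact h1
        have hnub : classNu b p y = -(M : ℤ) + 1 := by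
          by_cases hne : classNu b p y = classExp b p y
          · rw [hne, ← heq]; exact hE'
          · exfalso
            obtain ⟨h1b', -⟩ := tame_of_classNu_ne b hne
            have htame : tameSingle b p y = true := by
              by_contra ht; apply hne; unfold classNu; rw [if_neg (fun h => ht h.2)]
            have ht' := tameSingle_shift b hb hb' hj1 hj7 h1b' h1 htame
            have h1' : classPoleCount (shift b j) p y = 1 := by
              rw [classPoleCount_shift_of_classExp_eq b hb.1 hj1 heq]; exact h1b'
            apply (show classNu (shift b j) p y ≠ classExp (shift b j) p y from ?_) hEq
            intro h
            have : 0 ≤ classNu (shift b j) p y := by unfold classNu; rw [if_pos ⟨h1', ht'⟩]; exact le_max_right _ _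
            omega
        rw [classTypeList_shift_of_unhit b hb hb' hj1 hj7 heq hyn, shift_zero b hj1, centreIn_shift b hj1]
        exact H4 y hy h1b hnub
      · -- hit: `y` was deep in `b`
        have hlt : classExp b p y + 1 ≤ classExp (shift b j) p y := by omega
        by_cases h2b : 2 ≤ classPoleCount b p y
        · have hEb := H1 y (mem_filter.2 ⟨mem_range.2 hy, h2b⟩)
          have hEm : classExp b p y = -(M : ℤ) := by omega
          obtain ⟨hc, htl⟩ := H3 y (mem_filter.2 ⟨mem_range.2 hy, h2b⟩) hEm
          -- exactly one moved point in the class, at some level ℓ₀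
          have h2 := two_mul_le_of_shift b hj1 hj7 hb'
          have hsum := classExp_shift_eq b hb hj1 hj7 hb' p y
          have hone : ∑ s ∈ classSet b p y,
              (if s = (b j).toNat ∨ s = (b 0).toNat - (b j).toNat then (1 : ℤ) else 0) = 1 := by omega
          rw [sum_boole] at hone
          have hcard : ((classSet b p y).filter fun s => s = (b j).toNat ∨ s = (b 0).toNat - (b j).toNat).card = 1 := by
            exact_mod_cast hone
          obtain ⟨s₀, hs₀⟩ := card_eq_one.1 hcard
          have hs₀mem : s₀ ∈ (classSet b p y).filter fun s => s = (b j).toNat ∨ s = (b 0).toNat - (b j).toNat := by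
            rw [hs₀]; exact mem_singleton_self _
          obtain ⟨hs₀c, hs₀mv⟩ := mem_filter.1 hs₀mem
          obtain ⟨hL, hL'⟩ := level_bounds' (p := p) b hyn
          set L := topLevel b p y with hLdef
          rw [LevelClass.classSet_level b hy hL hL'] at hs₀c
          obtain ⟨ℓ₀, hℓ₀, rfl⟩ := mem_image.1 hs₀c
          have hℓ₀L : ℓ₀ ≤ L := by have := mem_range.1 hℓ₀; omega
          -- the new exponents along the levels
          have hnew : ∀ ℓ ≤ L, netExp (shift b j) (y + ℓ * p) = raiseAt (fun k => netExp b (y + k * p)) ℓ₀ ℓ := by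
            intro ℓ hℓ
            rw [CellA.netExp_shift_eq b hb.1 hj1 hj7 h2, raiseAt]
            have hmem : y + ℓ * p ∈ classSet b p y := LevelClass.level_mem b hy hL hL' hℓ
            by_cases hℓℓ : ℓ = ℓ₀
            · subst hℓℓ; rw [if_pos hs₀mv, if_pos rfl]
            · have hnot : ¬ (y + ℓ * p = (b j).toNat ∨ y + ℓ * p = (b 0).toNat - (b j).toNat) := by
                intro h
                have : y + ℓ * p ∈ (classSet b p y).filter fun s => s = (b j).toNat ∨ s = (b 0).toNat - (b j).toNat :=
                  mem_filter.2 ⟨hmem, h⟩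
                rw [hs₀, mem_singleton] at this
                exact hℓℓ (LevelClass.level_injective hp0 y this)
              rw [if_neg hnot, if_neg hℓℓ, add_zero]
          left
          have htop : topLevel (shift b j) p y = L := by rw [hLdef]; unfold topLevel; rw [shift_zero b hj1]
          have hS : classTypeList (shift b j) p y = (List.range (L + 1)).map (raiseAt (fun k => netExp b (y + k * p)) ℓ₀) := by
            unfold classTypeList
            rw [htop]
            exact List.map_congr_left fun ℓ hℓ => hnew ℓ (by have := List.mem_range.1 hℓ; omega)
          have hT' : T = (List.range (L + 1)).map (fun k => netExp b (y + k * p)) := by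
            rw [← htl]; exact classTypeList_level b hL hL'
          rw [hS, ← mapIdx_range_map, ← hT']
          unfold isRaise
          simp only [Bool.or_eq_true, List.any_eq_true, beq_iff_eq]
          left; left
          refine ⟨ℓ₀, List.mem_range.2 ?_, rfl⟩
          rw [hT']; simp; omega
        · -- a hit single class: tame, contradiction
          exfalso
          have h1b : classPoleCount b p y = 1 := by omega
          have hnub := H2 y hy h1b
          have hne : classNu b p y ≠ classExp b p y := by omega
          have htame : tameSingle b p y = true := by
            by_contra ht; apply hne; unfold classNu; rw [if_neg (fun h => ht h.2)]
          have ht' := tameSingle_shift b hb hb' hj1 hj7 h1b h1 htame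
          have h1' : classPoleCount (shift b j) p y = 1 := by omega
          have : 0 ≤ classNu (shift b j) p y := by unfold classNu; rw [if_pos ⟨h1', ht'⟩]; exact le_max_right _ _
          omega

  obtain ⟨α', X', Y', hX1', hY1', hK', hV', hXa', hYa'⟩ := aggregateK (shift b j) hb' hp5 hpb' hwin' hM hMe hT
    (H1_shift b hb hj1 H1) H2' (H3_shift b hb hb' hj1 hj7 hpb H1 H3) H4'
  -- the Casoratian in `𝒦`-form: both moment parts vanish for `p ≤ d`
  have hdshift : dOf (shift b j) = dOf b - 1 := dOf_shift b hj1 hj7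
  have hΩ : omegaRes b p = 0 := omegaRes_eq_zero b hb (by omega)
  have hΩ' : omegaRes (shift b j) p = 0 := omegaRes_eq_zero (shift b j) hb' (by rw [hdshift]; omega)
  -- the minor
  set w := kRes b p / (-(p : ℚ)) ^ (-(M : ℤ) + 3)
  set v := coeffV b / (-(p : ℚ)) ^ (-(M : ℤ))
  set w' := kRes (shift b j) p / (-(p : ℚ)) ^ (-(M : ℤ) + 3)
  set v' := coeffV (shift b j) / (-(p : ℚ)) ^ (-(M : ℤ))
  have hdet := det_small hK hV hK' hV' hX1 hY1 hX1' hY1' hXa hYa hXa' hYa'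
  have hcasE : casoratian b j = -((-(p : ℚ)) ^ (-(M : ℤ) + 3) * (-(p : ℚ)) ^ (-(M : ℤ)) * (w' * v - w * v')) := by
    have e1 : kRes b p = w * (-(p : ℚ)) ^ (-(M : ℤ) + 3) := by
      simp only [w]; rw [div_mul_cancel₀ _ (zpow_ne_zero _ hpneg)]
    have e2 : coeffV b = v * (-(p : ℚ)) ^ (-(M : ℤ)) := by
      simp only [v]; rw [div_mul_cancel₀ _ (zpow_ne_zero _ hpneg)]
    have e3 : kRes (shift b j) p = w' * (-(p : ℚ)) ^ (-(M : ℤ) + 3) := by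
      simp only [w']; rw [div_mul_cancel₀ _ (zpow_ne_zero _ hpneg)]
    have e4 : coeffV (shift b j) = v' * (-(p : ℚ)) ^ (-(M : ℤ)) := by
      simp only [v']; rw [div_mul_cancel₀ _ (zpow_ne_zero _ hpneg)]
    rw [casoratian_split b j p, hΩ, hΩ', e1, e2, e3, e4]; ring
  apply val_ge_of_padicNorm_le hcas
  rw [hcasE, padicNorm.neg, padicNorm.mul, padicNorm.mul, LevelClass.padicNorm_neg_p_zpow, LevelClass.padicNorm_neg_p_zpow]
  calc (p : ℚ) ^ (-(-(M : ℤ) + 3)) * (p : ℚ) ^ (-(-(M : ℤ))) * padicNorm p (w' * v - w * v')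
      ≤ (p : ℚ) ^ (-(-(M : ℤ) + 3)) * (p : ℚ) ^ (-(-(M : ℤ))) * (p : ℚ) ^ (-(3 : ℤ)) :=
        mul_le_mul_of_nonneg_left hdet (mul_nonneg (zpow_p_nonneg _) (zpow_p_nonneg _))
    _ = (p : ℚ) ^ (-((6 : ℤ) - 2 * M)) := by
        rw [← zpow_add₀ hp0, ← zpow_add₀ hp0]; congr 1; ring

/-- **THEOREM A‴₄** (the frame `M = 4`; K-A‴₄): under the class hypotheses of `LawA3` at `M = 4` and `p ≤ d`, `v_p(Cas_j(b)) ≥ −2`. -/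
theorem lawA3_four (b : ℕ → ℤ) (p j : ℕ) (T : List ℤ) (hb : InPolytope b) (hb' : InPolytope (shift b j)) (hj1 : 1 ≤ j) (hj7 : j ≤ 7)
    (hprime : p.Prime) (hp5 : 5 ≤ p) (hpb : (p : ℤ) ≤ b 0) (hwin : (b 0 + 2 : ℤ) < (p : ℤ) ^ 2) (hpd : (p : ℤ) ≤ dOf b)
    (hT : T.reverse = T)
    (H1 : ∀ x ∈ multipoleClasses b p, -(4 : ℤ) ≤ classExp b p x)
    (H2 : ∀ y, y < p → classPoleCount b p y = 1 → -(4 : ℤ) + 1 ≤ classNu b p y)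
    (H3 : ∀ x ∈ multipoleClasses b p, classExp b p x = -(4 : ℤ) → ¬ CentreIn b p x ∧ classTypeList b p x = T)
    (H4 : ∀ y, y < p → 1 ≤ classPoleCount b p y → classNu b p y = -(4 : ℤ) + 1 →
      isRaise T (classTypeList b p y) = true ∨ (¬ (2 : ℤ) ∣ b 0 ∧ CentreIn b p y ∧ classTypeList b p y = T))
    (hcas : casoratian b j ≠ 0) : (-2 : ℤ) ≤ padicValRat p (casoratian b j) := by
  have h := lawA3K b p j 4 T hb hb' hj1 hj7 hprime hp5 hpb hwin hpd le_rfl (by decide) hT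
    (by exact_mod_cast H1) (by exact_mod_cast H2) (by exact_mod_cast H3) (by exact_mod_cast H4) hcas
  push_cast at h
  linarith

end Summit.KontsevichZagierPeriods.Zeta5Search.SecondOrder

end
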